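/-
Copyright (c) 2026 the pub-hodgecm-mathlib formalisation cell (harness21).  Prover seat hodgecm-mathlib-K2Liu-p27 (g0): Track B «K2-LIT»,
hLiu418 = stmt-HodgeConjecture-24832; LEAD F0P6-plan (g14) BATCH #58 (1) «(F-GK-3) FILE B» (self-executing re-deal 21:55Z; first hand K2Liu-p05 (g7)),
consumer (F-GK-4) ED. 2 K2E5-p16 (g8); books K2E5-plan.
-/
import Summits.HodgeConjecture.HodgeConjecture.Theorems.K2LiuSiegelCocycleSphericalValueNormalised  -- ★ (F-GK-3) FILE A p862135: the unit scalars, non-split value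
import Summits.HodgeConjecture.HodgeConjecture.Theorems.K2LiuSiegelCocycleSphericalValueSplit       -- ★ (F-GK-2s) p862280: the split value
import HarnessLib

/-!
# Crux `HLiu418`, road `K2_Liu`, #41 KIND 0 (β) Euler face, brick (E4) «GK spherical value», file (F-GK-3) B, part 1 (letters):
# THE LETTERS OF THE SIEGEL COCYCLE AT INTEGRAL POINTS LIE IN `K_v = H(𝒪_v)`, AND THE INTEGRAL COORDINATE BOX IS `N_Δ(F_v) ∩ K_v`

Cell `hodgecm-mathlib`, crux item hLiu418 = `stmt-HodgeConjecture-24832`; squad K2 ∕ K2Liu; prover K2Liu-p27 (g0).  THEOREMS ONLY (no `def`, no instance,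
no notation, no named-fact hypothesis, no `sorry`); lane `--supports stmt-HodgeConjecture-24832 --as helper` (count-neutral helper).  ONE FRAME (RULING
M-156o (c)): `φ := frameConj Q ∘ toLocalFour` (★ B1b-1); the adapted-frame data `(D, Dinv, Q)` are hypotheses, as in ★ B7, ★ (F-GK-2), ★ FILE A.

THE POINT.  ★ (F-GK-2) `K2LiuSiegelCocycleSphericalValue` (non-split) ∕ ★ (F-GK-2s) `K2LiuSiegelCocycleSphericalValueSplit` (split) evaluate the Siegel
intertwining operator of `U(2,2)(F_v)` on a section right-invariant under ANY open subgroup `K₀` containing the cocycle's letters at integral points, as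
`aNorm 2 χ_v (νN(BOX)) s · f(h)` with `BOX ⊆ N_Δ(F_v)` the integral coordinate box.  This file supplies what is needed to take `K₀ := K_v = H(𝒪_v)`
(★ `UnitaryGroup.localInt`) — the sequel `K2LiuSiegelCocycleSphericalLocalInt` then evaluates `M_v(s)` on the SPHERICAL section (★ D10 `IsSphericalSection`):
* §1 **the transport `φ = frameConj Q ∘ toLocalFour` maps integral elements of `U(J₄)(E ⊗ F_v)` into `K_v`**: for `g` with integral entries (then `g⁻¹ = J₄ σ(g)ᵀ J₄`
  has integral entries, `c ⊗ 1` preserving integrality), `adapt (matA (φ g)) = diag(1, D_v) · g · diag(1, D⁻¹_v)` (★ `adapt_matA_frameConj`) is integral when the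
  frame `D`, `D⁻¹` is `v`-integral, hence `matA (φ g) = R · adapt · R⁻¹` is integral when `|2|_w = 1`, and `φ g ∈ K_v` (★ `apply_mem_glInt_of_isIntegralAt`);
* §2 **the letters**: `φ(w₂)`, `φ(ℓ_{A_w})` (`A_w = (1−1_w, 1_w; 1_w, 1−1_w)`, an integral involution), `φ(u_{2e₂}(ι_v(t)δ^{±1}))` (`t ∈ 𝒪_{F_v}`, `|δ|_w = 1`),
  `φ(u₋(1_w ζ))` (`ζ ∈ 𝒪_{E_w}`) lie in `K_v` — the five ∕ seven letter binders of ★ (F-GK-2) §3 ∕ ★ (F-GK-2s) §3 at `K₀ := K_v`;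
* §3 **the integral coordinate box is `N_Δ(F_v) ∩ K_v`**: `φ(n(ι_v(b₁)δ, z, ι_v(b₂)δ)) ∈ K_v ↔ b₁, b₂ ∈ 𝒪_{F_v} ∧ z` integral (★ `mem_localInt_iff_isIntegralAt_blkB`:
  `B(φ n(x,z,y)) = X · D⁻¹_v`, `X = (z y; x −σz)`, ★ `adapt_matA_frameConj_nSiegel`), so `BOX = {u ∈ N_Δ(F_v) | u ∈ K_v}` at a non-split place (`z = 1_w ζ`) and at
  a split place (`z = 1_{w₁} ζ₁ + 1_{w₂} ζ₂`), by the surjectivity of the coordinates ★ `exists_homeomorph_coordTwo`.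
HONEST LABEL.  `HC_CM` is proved only modulo the 7 printed citations (2 remaining named inputs: hLiu418 = `stmt-HodgeConjecture-24832`,
h413 = `stmt-HodgeConjecture-24833`) until rung 0 closes.

## References
* [Casselman1980] W. Casselman, Compositio Math. 40 (1980), §3 Thm. 3.1.   * [Mok2014] C. P. Mok, Mem. AMS 235 (2015), §1.   * [Rogawski1990] J. Rogawski, Ann. Math. Stud. 123, §1.9.
* [HarrisKudlaSweet1996] M. Harris, S. Kudla, W. J. Sweet, J. AMS 9 (1996), §1 (1.11)–(1.12), §6 (6.14)–(6.16).
* [PlatonovRapinchuk1994] V. Platonov, A. Rapinchuk, *Algebraic Groups and Number Theory* (1994), §5.1 (integral points, change of frame).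
* [CasselsFrohlichANT1967] J. W. S. Cassels, A. Fröhlich (eds.), *Algebraic Number Theory* (1967), Ch. II §10–§11, Ch. VII §1.1.
-/

set_option autoImplicit false
set_option linter.dupNamespace false -- the mandated namespace repeats `HodgeConjecture.HodgeConjecture`

noncomputable section

open scoped Classical NNReal ENNReal
open NumberField IsDedekindDomain Matrix MeasureTheory Topology
open Literature.NumberTheory.GaloisRepresentations.IsNonarchimedeanLocalField
open Literature.NumberTheory.Automorphic Literature.NumberTheory.Automorphic.UnitaryGroup
open Literature.NumberTheory.GelbartRogawski1991.AdaptedBlocks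
open Literature.NumberTheory.GelbartRogawski1991.UnitaryDualPair.LocalSplitting
open Literature.NumberTheory.K2Lit.LocalSiegelDoubled
open Summit.HodgeConjecture.HodgeConjecture.Cruxes.HLiu418.K2LiuQRationalDefs Summit.HodgeConjecture.HodgeConjecture.Cruxes.HLiu418.K2LiuLocalLFactorDefs
open Summit.HodgeConjecture.HodgeConjecture.Cruxes.HLiu418.K2LiuLocalSiegelIwasawaFrame Summit.HodgeConjecture.HodgeConjecture.Cruxes.HLiu418.K2LiuLocalSiegelIwasawa
open Summit.HodgeConjecture.HodgeConjecture.Cruxes.HLiu418.K2LiuDoubledUTwoTwoBorelFrame Summit.HodgeConjecture.HodgeConjecture.Cruxes.HLiu418.K2LiuDoubledUTwoTwoWeylCocycle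
open Summit.HodgeConjecture.HodgeConjecture.Cruxes.HLiu418.K2LiuDoubledUTwoTwoLevi Summit.HodgeConjecture.HodgeConjecture.Cruxes.HLiu418.K2LiuDoubledUTwoTwoRankOneRelationsLevi
open Summit.HodgeConjecture.HodgeConjecture.Cruxes.HLiu418.K2LiuDoubledUTwoTwoFrameTransport Summit.HodgeConjecture.HodgeConjecture.Cruxes.HLiu418.K2LiuDoubledUTwoTwoUnipotentHaar
open Summit.HodgeConjecture.HodgeConjecture.Cruxes.HLiu418.K2LiuUnipDeltaLocalCoordinates Summit.HodgeConjecture.HodgeConjecture.Cruxes.HLiu418.K2LiuUnipDeltaRankOneCoordinates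
open Summit.HodgeConjecture.HodgeConjecture.Cruxes.HLiu418.K2LiuSiegelCocycleLetters Summit.HodgeConjecture.HodgeConjecture.Cruxes.HLiu418.K2LiuSiegelCocycleStageShort
open Summit.HodgeConjecture.HodgeConjecture.Cruxes.HLiu418.K2LiuSiegelIntertwiningCocycle Summit.HodgeConjecture.HodgeConjecture.Cruxes.HLiu418.K2LiuLocalRingPlaceDecomposition
open Summit.HodgeConjecture.HodgeConjecture.Cruxes.HLiu418.K2LiuA7NormalisedRegularitySetup Summit.HodgeConjecture.HodgeConjecture.Cruxes.HLiu418.K2LiuSiegelCocycleSphericalValue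
open Summit.HodgeConjecture.HodgeConjecture.Cruxes.HLiu418.K2LiuSiegelCocycleSphericalValueNormalised Summit.HodgeConjecture.HodgeConjecture.Cruxes.HLiu418.K2LiuSiegelCocycleSphericalValueSplit

namespace Summit.HodgeConjecture.HodgeConjecture.Cruxes.HLiu418.K2LiuSiegelCocycleLettersLocalInt

variable (F : Type) [Field F] [NumberField F] (E : Type) [Field E] [NumberField E] [Algebra F E]
  [Algebra.IsQuadraticExtension F E] (c : E ≃ₐ[F] E)
  {δ : E} (hcδ : c δ = -δ) (hδ : δ ≠ 0) {d : F} (hd : δ * δ = algebraMap F E d) (v : HeightOneSpectrum (𝓞 F))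
  {T₂ : Matrix (Fin 2) (Fin 2) F} (hT₂ : T₂.IsSymm) {J₂D : Matrix (Fin (2 + 2)) (Fin (2 + 2)) E} (hJ₂D : J₂D = (gramD F 2 T₂).map (algebraMap F E))
  (D Dinv : Matrix (Fin 2) (Fin 2) F) (hDD : D * Dinv = 1) (hDD' : Dinv * D = 1) (Q : GL (Fin (2 + 2)) F)
  (hQm : (Q : Matrix (Fin (2 + 2)) (Fin (2 + 2)) F) = Matrix.reindex (e₂ 2) (e₂ 2) (Matrix.fromBlocks 1 D 1 (-D)))
  (hQ : (Q : Matrix (Fin (2 + 2)) (Fin (2 + 2)) F)ᵀ * gramD F 2 T₂ * (Q : Matrix (Fin (2 + 2)) (Fin (2 + 2)) F) = (StdForm.antidiagonal (2 + 2)).over F)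
  (h2 : ∀ w : PlacesOver E v, ValuativeRel.valuation (w.1.adicCompletion E) (2 : w.1.adicCompletion E) = 1)
  (hδv : ∀ w : PlacesOver E v, ValuativeRel.valuation (w.1.adicCompletion E) (algebraMap E (w.1.adicCompletion E) δ) = 1)
  (hDw : ∀ (w : PlacesOver E v) (i j : Fin 2), ValuativeRel.valuation (w.1.adicCompletion E) (algebraMap E (w.1.adicCompletion E) (algebraMap F E (D i j))) ≤ 1)
  (hDiw : ∀ (w : PlacesOver E v) (i j : Fin 2), ValuativeRel.valuation (w.1.adicCompletion E) (algebraMap E (w.1.adicCompletion E) (algebraMap F E (Dinv i j))) ≤ 1)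

/-! ## §1 The transport `φ = frameConj Q ∘ toLocalFour` maps integral letters of `U(J₄)(E ⊗ F_v)` into `K_v = H(𝒪_v)` -/

omit [NumberField F] [Algebra.IsQuadraticExtension F E] in
/-- a matrix over `E ⊗ F_v` with integral entries is integral at every `w ∣ v`. [cite: CasselsFrohlichANT1967, Ch. II §10] -/
theorem isIntegralAt_of_isIntegralLoc {m : Type*} {M : Matrix m m (UnitaryGroup.LocalRing E v)} (hM : ∀ i j, IsIntegralLoc F E v (M i j))
    (w : PlacesOver E v) : IsIntegralAt F E v w M :=
  fun i j => hM i j w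

omit [NumberField F] [Algebra.IsQuadraticExtension F E] in
/-- `1 ∈ E ⊗ F_v` is integral. [cite: CasselsFrohlichANT1967, Ch. II §10] -/
theorem isIntegralLoc_one : IsIntegralLoc F E v (1 : UnitaryGroup.LocalRing E v) := fun w => by rw [Pi.one_apply, map_one]

omit [NumberField F] [Algebra.IsQuadraticExtension F E] in
/-- entries of a product of matrices with integral entries are integral. [cite: CasselsFrohlichANT1967, Ch. II §10] -/
theorem isIntegralLoc_mul_apply {m : Type*} [Fintype m] {M N : Matrix m m (UnitaryGroup.LocalRing E v)} (hM : ∀ i j, IsIntegralLoc F E v (M i j))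
    (hN : ∀ i j, IsIntegralLoc F E v (N i j)) (i j : m) : IsIntegralLoc F E v ((M * N) i j) := by
  rw [Matrix.mul_apply]
  exact IsIntegralLoc.sum _ fun k _ => (hM i k).mul (hN k j)

omit [NumberField F] [Algebra.IsQuadraticExtension F E] in
/-- the entries of `J₄` are integral. [cite: Mok2014, §1 Notation p. 5] -/
theorem isIntegralLoc_antidiagFour (i j : Fin 4) : IsIntegralLoc F E v (antidiagFour (UnitaryGroup.LocalRing E v) i j) := by
  fin_cases i <;> fin_cases j <;> simp [antidiagFour, isIntegralLoc_one F E v, (IsIntegralLoc.zero : IsIntegralLoc F E v (0 : UnitaryGroup.LocalRing E v))]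

omit [Algebra.IsQuadraticExtension F E] in
/-- **the inverse in `U(J₄)`: `g⁻¹ = J₄ σ(g)ᵀ J₄`** (`σ(g)ᵀ J₄ g = J₄`, `J₄² = 1`). [cite: Mok2014, §1 Notation p. 5] [cite: Rogawski1990, §1.9 p. 13] -/
theorem coe_inv_eq (g : unitaryGroupOfForm (UnitaryGroup.conjLocal E c v) ((StdForm.antidiagonal 4).over (UnitaryGroup.LocalRing E v))) :
    ((g⁻¹ : unitaryGroupOfForm (UnitaryGroup.conjLocal E c v) ((StdForm.antidiagonal 4).over (UnitaryGroup.LocalRing E v))) :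
        GL (Fin 4) (UnitaryGroup.LocalRing E v)).1 =
      antidiagFour (UnitaryGroup.LocalRing E v) * ((g : GL (Fin 4) (UnitaryGroup.LocalRing E v)).1.map (UnitaryGroup.conjLocal E c v))ᵀ *
        antidiagFour (UnitaryGroup.LocalRing E v) := by
  rw [Subgroup.coe_inv, Matrix.coe_units_inv, ← antidiagonal_over_four]
  refine Matrix.inv_eq_left_inv ?_
  rw [Matrix.mul_assoc ((StdForm.antidiagonal 4).over _), Matrix.mul_assoc ((StdForm.antidiagonal 4).over _), mem_unitaryGroupOfForm_iff.1 g.2]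
  exact StdForm.over_mul_over _ _

omit [Algebra.IsQuadraticExtension F E] in
/-- **`g ∈ U(J₄)(E ⊗ F_v)` with integral entries has an inverse with integral entries** (`g⁻¹ = J₄ σ(g)ᵀ J₄`, `c ⊗ 1` preserves integrality).
[cite: PlatonovRapinchuk1994, §5.1] [cite: CasselsFrohlichANT1967, Ch. VII §1.1] -/
theorem isIntegralLoc_coe_inv (g : unitaryGroupOfForm (UnitaryGroup.conjLocal E c v) ((StdForm.antidiagonal 4).over (UnitaryGroup.LocalRing E v)))
    (hg : ∀ i j, IsIntegralLoc F E v ((g : GL (Fin 4) (UnitaryGroup.LocalRing E v)).1 i j)) (i j : Fin 4) :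
    IsIntegralLoc F E v (((g⁻¹ : unitaryGroupOfForm (UnitaryGroup.conjLocal E c v) ((StdForm.antidiagonal 4).over (UnitaryGroup.LocalRing E v))) :
        GL (Fin 4) (UnitaryGroup.LocalRing E v)).1 i j) := by
  rw [coe_inv_eq]
  refine isIntegralLoc_mul_apply F E v (isIntegralLoc_mul_apply F E v (isIntegralLoc_antidiagFour F E v) fun k l => ?_)
    (isIntegralLoc_antidiagFour F E v) i j
  rw [Matrix.transpose_apply, Matrix.map_apply]
  exact IsIntegralLoc.conj c (hg l k)

omit [Algebra.IsQuadraticExtension F E] in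
/-- `M = R · adapt(M) · R⁻¹` (`adapt M = R⁻¹ M R`). [cite: HarrisKudlaSweet1996, §1 (1.11)] -/
theorem eq_cayR_mul_adapt_mul_cayRinv (M : Matrix (Fin 2 ⊕ Fin 2) (Fin 2 ⊕ Fin 2) (UnitaryGroup.LocalRing E v)) :
    M = cayR (UnitaryGroup.LocalRing E v) (Fin 2) * adapt M * cayRinv (UnitaryGroup.LocalRing E v) (Fin 2) := by
  rw [adapt]
  simp only [Matrix.mul_assoc]
  rw [cayR_mul_cayRinv, Matrix.mul_one, ← Matrix.mul_assoc, cayR_mul_cayRinv, Matrix.one_mul]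

omit [Algebra.IsQuadraticExtension F E] in
include hJ₂D hDD hQm h2 hDw hDiw in
/-- **the matrix over `E ⊗ F_v` of `φ g` is integral** when `g ∈ U(J₄)(E ⊗ F_v)` has integral entries, the frame `D`, `D⁻¹` is integral and `|2|_w = 1`:
`matA (φ g) = R · diag(1, D_v) · g · diag(1, D⁻¹_v) · R⁻¹` (★ `adapt_matA_frameConj`). [cite: HarrisKudlaSweet1996, §1 (1.11)] [cite: PlatonovRapinchuk1994, §5.1] -/
theorem isIntegralAt_matA_frameConj_toLocalFour
    (g : unitaryGroupOfForm (UnitaryGroup.conjLocal E c v) ((StdForm.antidiagonal 4).over (UnitaryGroup.LocalRing E v)))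
    (hg : ∀ i j, IsIntegralLoc F E v ((g : GL (Fin 4) (UnitaryGroup.LocalRing E v)).1 i j)) (w : PlacesOver E v) :
    IsIntegralAt F E v w (matA F E c v 2 (FrameTransport.frameConj F E c v (2 + 2) hJ₂D (antidiagonal_over_eq_map F E 2) Q hQ (toLocalFour F E c v g))) := by
  have hφw : ∀ x : F, ((UnitaryGroup.toLocalRing E v).comp (algebraMap F (v.adicCompletion F))) x w =
      algebraMap E (w.1.adicCompletion E) (algebraMap F E x) := fun x => toPlace_coe v w x
  have hblk : ∀ {X : Matrix (Fin 2) (Fin 2) F},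
      (∀ i j : Fin 2, ValuativeRel.valuation (w.1.adicCompletion E) (algebraMap E (w.1.adicCompletion E) (algebraMap F E (X i j))) ≤ 1) →
      IsIntegralAt F E v w (Matrix.fromBlocks (1 : Matrix (Fin 2) (Fin 2) (UnitaryGroup.LocalRing E v)) 0 0
        (X.map ((UnitaryGroup.toLocalRing E v).comp (algebraMap F (v.adicCompletion F))))) := by
    intro X hX
    refine IsIntegralAt.fromBlocks IsIntegralAt.one (fun i j => by simp) (fun i j => by simp) fun i j => ?_
    rw [Matrix.map_apply, Pi.evalRingHom_apply, Matrix.map_apply, hφw]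
    exact hX i j
  have hM := eq_cayR_mul_adapt_mul_cayRinv F E v
    (matA F E c v 2 (FrameTransport.frameConj F E c v (2 + 2) hJ₂D (antidiagonal_over_eq_map F E 2) Q hQ (toLocalFour F E c v g)))
  rw [adapt_matA_frameConj F E c v 2 hJ₂D D Dinv hDD Q hQm hQ, matS_toLocalFour, Matrix.reindex_apply] at hM
  rw [hM]
  exact isIntegralAt_conj F E v 2 w (h2 w) (((hblk (hDw w)).mul ((isIntegralAt_of_isIntegralLoc F E v hg w).submatrix _ _)).mul (hblk (hDiw w)))

omit [Algebra.IsQuadraticExtension F E] in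
include hJ₂D hDD hQm h2 hDw hDiw in
/-- **`φ g ∈ K_v = H(𝒪_v)`** for `g ∈ U(J₄)(E ⊗ F_v)` with integral entries (frame integral, `|2|_w = 1`): the `w`-components of `matA (φ g)` and
`matA (φ g⁻¹)` are integral (★ `apply_mem_glInt_of_isIntegralAt`). [cite: PlatonovRapinchuk1994, §5.1] [cite: Casselman1980, §3] -/
theorem frameConj_toLocalFour_mem_localInt
    (g : unitaryGroupOfForm (UnitaryGroup.conjLocal E c v) ((StdForm.antidiagonal 4).over (UnitaryGroup.LocalRing E v)))
    (hg : ∀ i j, IsIntegralLoc F E v ((g : GL (Fin 4) (UnitaryGroup.LocalRing E v)).1 i j)) :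
    FrameTransport.frameConj F E c v (2 + 2) hJ₂D (antidiagonal_over_eq_map F E 2) Q hQ (toLocalFour F E c v g) ∈
      UnitaryGroup.localInt E c (2 + 2) J₂D v := by
  rw [UnitaryGroup.mem_localInt_iff]
  intro w
  refine apply_mem_glInt_of_isIntegralAt F E c v 2 w _ (isIntegralAt_matA_frameConj_toLocalFour F E c v hJ₂D D Dinv hDD Q hQm hQ h2 hDw hDiw g hg w) ?_
  rw [← map_inv, ← map_inv]
  exact isIntegralAt_matA_frameConj_toLocalFour F E c v hJ₂D D Dinv hDD Q hQm hQ h2 hDw hDiw g⁻¹ (isIntegralLoc_coe_inv F E c v g hg) w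

/-! ## §2 The letters of the cocycle at integral points lie in `K_v` -/

omit [NumberField F] [Algebra.IsQuadraticExtension F E] in
/-- the entries of `w₂` are integral. [cite: Casselman1980, §3] -/
theorem isIntegralLoc_weylTwoM (i j : Fin 4) : IsIntegralLoc F E v (weylTwoM (UnitaryGroup.LocalRing E v) i j) := by
  fin_cases i <;> fin_cases j <;> simp [weylTwoM, isIntegralLoc_one F E v, (IsIntegralLoc.zero : IsIntegralLoc F E v (0 : UnitaryGroup.LocalRing E v))]

omit [NumberField F] [Algebra.IsQuadraticExtension F E] in
/-- the entries of `u_{2e₂}(x)` are integral when `x` is. [cite: Casselman1980, §3] -/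
theorem isIntegralLoc_uLongTwoM {x : UnitaryGroup.LocalRing E v} (hx : IsIntegralLoc F E v x) (i j : Fin 4) :
    IsIntegralLoc F E v (uLongTwoM (UnitaryGroup.LocalRing E v) x i j) := by
  fin_cases i <;> fin_cases j <;> simp [uLongTwoM, isIntegralLoc_one F E v, (IsIntegralLoc.zero : IsIntegralLoc F E v (0 : UnitaryGroup.LocalRing E v)), hx]

omit [Algebra.IsQuadraticExtension F E] in
/-- the entries of `u₋(z)` (`1, z, −σ z`) are integral when `z` is. [cite: Casselman1980, §3] [cite: CasselsFrohlichANT1967, Ch. VII §1.1] -/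
theorem isIntegralLoc_uMinusM {z : UnitaryGroup.LocalRing E v} (hz : IsIntegralLoc F E v z) (i j : Fin 4) :
    IsIntegralLoc F E v (uMinusM (UnitaryGroup.LocalRing E v) (UnitaryGroup.conjLocal E c v) z i j) := by
  have hσ : IsIntegralLoc F E v (-UnitaryGroup.conjLocal E c v z) := (IsIntegralLoc.conj c hz).neg
  fin_cases i <;> fin_cases j <;> simp [uMinusM, isIntegralLoc_one F E v, (IsIntegralLoc.zero : IsIntegralLoc F E v (0 : UnitaryGroup.LocalRing E v)), hz, hσ]

omit [Algebra.IsQuadraticExtension F E] in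
/-- the entries of the Levi letter `m(A) = diag(A, W σ(A⁻¹)ᵀ W)` are integral when `A` and `A⁻¹` are. [cite: HarrisKudlaSweet1996, §1 (1.11)] -/
theorem isIntegralLoc_leviM {A : GL (Fin 2) (UnitaryGroup.LocalRing E v)} (hA : ∀ i j, IsIntegralLoc F E v (A.1 i j))
    (hAi : ∀ i j, IsIntegralLoc F E v (A.1⁻¹ i j)) (i j : Fin 4) :
    IsIntegralLoc F E v (leviM (UnitaryGroup.LocalRing E v) (UnitaryGroup.conjLocal E c v) A i j) := by
  have hσ : ∀ i j, IsIntegralLoc F E v (UnitaryGroup.conjLocal E c v (A.1⁻¹ i j)) := fun i j => IsIntegralLoc.conj c (hAi i j)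
  fin_cases i <;> fin_cases j <;> simp [leviM, (IsIntegralLoc.zero : IsIntegralLoc F E v (0 : UnitaryGroup.LocalRing E v)), hA, hσ]

omit [Algebra.IsQuadraticExtension F E] in
/-- **`ι_v(t) · e` is integral** for `t ∈ 𝒪_{F_v}` and `e ∈ E` integral at every `w ∣ v` (`e = δ^{±1}` at a good place). [cite: CasselsFrohlichANT1967, Ch. II §10] -/
theorem isIntegralLoc_coord_of_mem {t : v.adicCompletion F} (ht : t ∈ primePowBall (v.adicCompletion F) 0) {e : E}
    (he : ∀ w : PlacesOver E v, ValuativeRel.valuation (w.1.adicCompletion E) (algebraMap E (w.1.adicCompletion E) e) ≤ 1) :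
    IsIntegralLoc F E v (UnitaryGroup.toLocalRing E v t * algebraMap E (UnitaryGroup.LocalRing E v) e) :=
  ((isIntegralLoc_toLocalRing_iff F E v t).2 ((mem_primePowBall_zero_iff_valued F v t).1 ht)).mul (isIntegralLoc_algebraMap F E v he)

omit [NumberField F] [Algebra.IsQuadraticExtension F E] in
/-- **`1_w ζ` is integral** for `ζ ∈ 𝒪_{E_w}`. [cite: CasselsFrohlichANT1967, Ch. II §10–§11] -/
theorem isIntegralLoc_single_of_mem {w : PlacesOver E v} {ζ : w.1.adicCompletion E} (hζ : ζ ∈ primePowBall (w.1.adicCompletion E) 0) :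
    IsIntegralLoc F E v (Pi.single w ζ : UnitaryGroup.LocalRing E v) := by
  intro w'
  by_cases h : w' = w
  · subst h
    rw [Pi.single_eq_same, valuation_le_one_iff_valued]
    exact (mem_primePowBall_zero_iff_valued E w'.1 ζ).1 hζ
  · rw [Pi.single_eq_of_ne h, map_zero]
    exact zero_le

omit [NumberField F] [Algebra.IsQuadraticExtension F E] in
/-- **the partial Weyl matrix `A_w = (1−1_w, 1_w; 1_w, 1−1_w)` is an integral involution**: its entries and the entries of `A_w⁻¹ = A_w` are integral.
[cite: HarrisKudlaSweet1996, §6 (6.16)] [cite: CasselsFrohlichANT1967, Ch. II §11] -/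
theorem isIntegralLoc_partialWeyl (w : PlacesOver E v) (A : GL (Fin 2) (UnitaryGroup.LocalRing E v))
    (hA : A.val = !![1 - Pi.single w 1, Pi.single w 1; Pi.single w 1, 1 - Pi.single w 1]) :
    (∀ i j, IsIntegralLoc F E v (A.1 i j)) ∧ ∀ i j, IsIntegralLoc F E v (A.1⁻¹ i j) := by
  have h1 : IsIntegralLoc F E v (Pi.single w (1 : w.1.adicCompletion E) : UnitaryGroup.LocalRing E v) :=
    isIntegralLoc_single_of_mem F E v ((mem_primePowBall_zero_iff_valued E w.1 (1 : w.1.adicCompletion E)).2 (by rw [map_one]))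
  have h1' : IsIntegralLoc F E v ((1 : UnitaryGroup.LocalRing E v) - Pi.single w (1 : w.1.adicCompletion E)) := (isIntegralLoc_one F E v).sub h1
  have hent : ∀ i j, IsIntegralLoc F E v (A.1 i j) := by
    intro i j
    rw [hA]
    fin_cases i <;> fin_cases j <;> simp [h1, h1']
  -- `A_w² = 1` (`1_w` is idempotent), hence `A_w⁻¹ = A_w`
  have hM : (!![1 - Pi.single w 1, Pi.single w 1; Pi.single w 1, 1 - Pi.single w 1] : Matrix (Fin 2) (Fin 2) (UnitaryGroup.LocalRing E v)) =
      (Pi.single w (1 : w.1.adicCompletion E) : UnitaryGroup.LocalRing E v) • !![0, 1; 1, 0] +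
        ((1 : UnitaryGroup.LocalRing E v) - Pi.single w (1 : w.1.adicCompletion E)) • (1 : Matrix (Fin 2) (Fin 2) (UnitaryGroup.LocalRing E v)) :=
    Matrix.ext fun i j => by fin_cases i <;> fin_cases j <;> simp
  have hMM : A.1 * A.1 = 1 := by
    rw [hA, hM, comb_mul_comb (single_one_mul_single_one F E v w), antidiagTwo'_mul_self F E v, one_mul, ← add_smul, add_sub_cancel, one_smul]
  refine ⟨hent, fun i j => ?_⟩
  rw [Matrix.inv_eq_left_inv hMM]
  exact hent i j

omit [Algebra.IsQuadraticExtension F E] in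
include hJ₂D hDD hQm h2 hDw hDiw in
/-- **`φ(w₂) ∈ K_v`.** [cite: Casselman1980, §3] [cite: PlatonovRapinchuk1994, §5.1] -/
theorem frameConj_weylTwo_mem_localInt :
    FrameTransport.frameConj F E c v (2 + 2) hJ₂D (antidiagonal_over_eq_map F E 2) Q hQ
        (toLocalFour F E c v (weylTwo (UnitaryGroup.LocalRing E v) (UnitaryGroup.conjLocal E c v))) ∈ UnitaryGroup.localInt E c (2 + 2) J₂D v :=
  frameConj_toLocalFour_mem_localInt F E c v hJ₂D D Dinv hDD Q hQm hQ h2 hDw hDiw _ (isIntegralLoc_weylTwoM F E v)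

include hJ₂D hDD hQm h2 hDw hDiw in
/-- **`φ(ℓ_{A_w}) ∈ K_v`** for the partial Weyl letter `A_w = (1−1_w, 1_w; 1_w, 1−1_w)`. [cite: HarrisKudlaSweet1996, §6 (6.16)] [cite: PlatonovRapinchuk1994, §5.1] -/
theorem frameConj_leviElt_partialWeyl_mem_localInt (w : PlacesOver E v) (A : GL (Fin 2) (UnitaryGroup.LocalRing E v))
    (hA : A.val = !![1 - Pi.single w 1, Pi.single w 1; Pi.single w 1, 1 - Pi.single w 1]) :
    FrameTransport.frameConj F E c v (2 + 2) hJ₂D (antidiagonal_over_eq_map F E 2) Q hQ (toLocalFour F E c v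
        (leviElt (UnitaryGroup.LocalRing E v) (UnitaryGroup.conjLocal E c v) (UnitaryGroup.conjLocal_conjLocal c v hcδ hδ) A)) ∈
      UnitaryGroup.localInt E c (2 + 2) J₂D v :=
  frameConj_toLocalFour_mem_localInt F E c v hJ₂D D Dinv hDD Q hQm hQ h2 hDw hDiw _
    (isIntegralLoc_leviM F E c v (isIntegralLoc_partialWeyl F E v w A hA).1 (isIntegralLoc_partialWeyl F E v w A hA).2)

omit [Algebra.IsQuadraticExtension F E] in
include hJ₂D hDD hQm h2 hδv hDw hDiw in
/-- **`φ(u_{2e₂}(ι_v(t)δ)) ∈ K_v`** for `t ∈ 𝒪_{F_v}` (`δ` a `w`-unit). [cite: Casselman1980, §3] [cite: PlatonovRapinchuk1994, §5.1] -/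
theorem frameConj_uLongTwo_coord_mem_localInt (t : v.adicCompletion F) (ht : t ∈ primePowBall (v.adicCompletion F) 0) :
    FrameTransport.frameConj F E c v (2 + 2) hJ₂D (antidiagonal_over_eq_map F E 2) Q hQ (toLocalFour F E c v
        (uLongTwo (UnitaryGroup.LocalRing E v) (UnitaryGroup.conjLocal E c v)
          (UnitaryGroup.toLocalRing E v t * algebraMap E (UnitaryGroup.LocalRing E v) δ) (conjLocal_coord F E c hcδ v t))) ∈
      UnitaryGroup.localInt E c (2 + 2) J₂D v :=
  frameConj_toLocalFour_mem_localInt F E c v hJ₂D D Dinv hDD Q hQm hQ h2 hDw hDiw _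
    (isIntegralLoc_uLongTwoM F E v (isIntegralLoc_coord_of_mem F E v ht fun w => (hδv w).le))

omit [Algebra.IsQuadraticExtension F E] in
include hJ₂D hDD hQm h2 hδv hDw hDiw in
/-- **`φ(u_{2e₂}(ι_v(t)δ⁻¹)) ∈ K_v`** for `t ∈ 𝒪_{F_v}` (`δ` a `w`-unit). [cite: Casselman1980, §3] [cite: PlatonovRapinchuk1994, §5.1] -/
theorem frameConj_uLongTwo_coord_inv_mem_localInt (t : v.adicCompletion F) (ht : t ∈ primePowBall (v.adicCompletion F) 0) :
    FrameTransport.frameConj F E c v (2 + 2) hJ₂D (antidiagonal_over_eq_map F E 2) Q hQ (toLocalFour F E c v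
        (uLongTwo (UnitaryGroup.LocalRing E v) (UnitaryGroup.conjLocal E c v)
          (UnitaryGroup.toLocalRing E v t * algebraMap E (UnitaryGroup.LocalRing E v) δ⁻¹) (conjLocal_coord_inv F E c hcδ v t))) ∈
      UnitaryGroup.localInt E c (2 + 2) J₂D v :=
  frameConj_toLocalFour_mem_localInt F E c v hJ₂D D Dinv hDD Q hQm hQ h2 hDw hDiw _
    (isIntegralLoc_uLongTwoM F E v (isIntegralLoc_coord_of_mem F E v ht fun w => by rw [map_inv₀, map_inv₀, hδv w, inv_one]))

include hJ₂D hDD hQm h2 hDw hDiw in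
/-- **`φ(u₋(1_w ζ)) ∈ K_v`** for `ζ ∈ 𝒪_{E_w}`. [cite: Casselman1980, §3] [cite: PlatonovRapinchuk1994, §5.1] -/
theorem frameConj_uMinus_single_mem_localInt (w : PlacesOver E v) (ζ : w.1.adicCompletion E) (hζ : ζ ∈ primePowBall (w.1.adicCompletion E) 0) :
    FrameTransport.frameConj F E c v (2 + 2) hJ₂D (antidiagonal_over_eq_map F E 2) Q hQ (toLocalFour F E c v
        (uMinus (UnitaryGroup.LocalRing E v) (UnitaryGroup.conjLocal E c v) (UnitaryGroup.conjLocal_conjLocal c v hcδ hδ) (Pi.single w ζ))) ∈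
      UnitaryGroup.localInt E c (2 + 2) J₂D v :=
  frameConj_toLocalFour_mem_localInt F E c v hJ₂D D Dinv hDD Q hQm hQ h2 hDw hDiw _
    (isIntegralLoc_uMinusM F E c v (isIntegralLoc_single_of_mem F E v hζ))

/-! ## §3 The integral coordinate box is `N_Δ(F_v) ∩ K_v` -/

include hJ₂D hDD hDD' hQm h2 hδv hDw hDiw in
/-- **`φ(n(ι_v(b₁)δ, z, ι_v(b₂)δ)) ∈ K_v ↔ b₁ ∈ 𝒪_{F_v} ∧ z integral ∧ b₂ ∈ 𝒪_{F_v}`** (frame integral, `|2|_w = |δ|_w = 1`): for `u ∈ N_Δ(F_v)`, `u ∈ K_v` iff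
its adapted block `B(u)` is integral (★ `mem_localInt_iff_isIntegralAt_blkB`), and `B(φ n(x,z,y)) = X · D⁻¹_v`, `X = (z y; x −σz)` (★ `adapt_matA_frameConj_nSiegel`).
[cite: HarrisKudlaSweet1996, §1 (1.11), §6 (6.14)–(6.16)] [cite: PlatonovRapinchuk1994, §5.1] -/
theorem frameConj_nSiegel_coord_mem_localInt_iff (b₁ : v.adicCompletion F) (z : UnitaryGroup.LocalRing E v) (b₂ : v.adicCompletion F) :
    FrameTransport.frameConj F E c v (2 + 2) hJ₂D (antidiagonal_over_eq_map F E 2) Q hQ (toLocalFour F E c v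
        (nSiegel (UnitaryGroup.LocalRing E v) (UnitaryGroup.conjLocal E c v) (UnitaryGroup.conjLocal_conjLocal c v hcδ hδ)
          (UnitaryGroup.toLocalRing E v b₁ * algebraMap E (UnitaryGroup.LocalRing E v) δ) z
          (UnitaryGroup.toLocalRing E v b₂ * algebraMap E (UnitaryGroup.LocalRing E v) δ) (conjLocal_coord F E c hcδ v b₁) (conjLocal_coord F E c hcδ v b₂))) ∈
        UnitaryGroup.localInt E c (2 + 2) J₂D v ↔
      b₁ ∈ primePowBall (v.adicCompletion F) 0 ∧ IsIntegralLoc F E v z ∧ b₂ ∈ primePowBall (v.adicCompletion F) 0 := by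
  have hφw : ∀ (w : PlacesOver E v) (x : F), ((UnitaryGroup.toLocalRing E v).comp (algebraMap F (v.adicCompletion F))) x w =
      algebraMap E (w.1.adicCompletion E) (algebraMap F E x) := fun w x => toPlace_coe v w x
  have hmap : ∀ {X : Matrix (Fin 2) (Fin 2) F}, (∀ (w : PlacesOver E v) (i j : Fin 2), ValuativeRel.valuation (w.1.adicCompletion E)
      (algebraMap E (w.1.adicCompletion E) (algebraMap F E (X i j))) ≤ 1) →
      ∀ w : PlacesOver E v, IsIntegralAt F E v w (X.map ((UnitaryGroup.toLocalRing E v).comp (algebraMap F (v.adicCompletion F)))) :=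
    fun hX w i j => by rw [Matrix.map_apply, Pi.evalRingHom_apply, Matrix.map_apply, hφw]; exact hX w i j
  obtain ⟨hD, hDi⟩ := And.intro (hmap hDw) (hmap hDiw)
  have hDiD : Dinv.map ((UnitaryGroup.toLocalRing E v).comp (algebraMap F (v.adicCompletion F))) *
      D.map ((UnitaryGroup.toLocalRing E v).comp (algebraMap F (v.adicCompletion F))) = 1 := by
    rw [← Matrix.map_mul, hDD', Matrix.map_one _ (map_zero _) (map_one _)]
  have hδw : ∀ w : PlacesOver E v, Valued.v ((δ : E) : w.1.adicCompletion E) = 1 := fun w => (valuation_eq_one_iff_valued E w.1 _).1 (hδv w)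
  obtain ⟨w₀⟩ := PlacesOver.nonempty E v
  rw [mem_localInt_iff_isIntegralAt_blkB F E c v 2 hJ₂D h2 (frameConj_nSiegel_mem_unipDeltaLocal F E c hcδ hδ v hJ₂D D Dinv hDD Q hQm hQ _ _ _ _ _),
    show blkB (matA F E c v 2 _) = (adapt (matA F E c v 2 (FrameTransport.frameConj F E c v (2 + 2) hJ₂D (antidiagonal_over_eq_map F E 2) Q hQ
      (toLocalFour F E c v (nSiegel (UnitaryGroup.LocalRing E v) (UnitaryGroup.conjLocal E c v) (UnitaryGroup.conjLocal_conjLocal c v hcδ hδ)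
        (UnitaryGroup.toLocalRing E v b₁ * algebraMap E (UnitaryGroup.LocalRing E v) δ) z
        (UnitaryGroup.toLocalRing E v b₂ * algebraMap E (UnitaryGroup.LocalRing E v) δ) (conjLocal_coord F E c hcδ v b₁) (conjLocal_coord F E c hcδ v b₂)))))).toBlocks₁₂ by
      rw [adapt_eq, Matrix.toBlocks_fromBlocks₁₂],
    adapt_matA_frameConj_nSiegel F E c hcδ hδ v hJ₂D D Dinv hDD Q hQm hQ, Matrix.toBlocks_fromBlocks₁₂]
  constructor
  · intro h
    have hX : ∀ w : PlacesOver E v, IsIntegralAt F E v w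
        (!![z, UnitaryGroup.toLocalRing E v b₂ * algebraMap E (UnitaryGroup.LocalRing E v) δ;
            UnitaryGroup.toLocalRing E v b₁ * algebraMap E (UnitaryGroup.LocalRing E v) δ, -UnitaryGroup.conjLocal E c v z] :
          Matrix (Fin 2) (Fin 2) (UnitaryGroup.LocalRing E v)) := fun w => by
      have h' := (h w).mul (hD w)
      rwa [Matrix.mul_assoc, hDiD, Matrix.mul_one] at h'
    exact ⟨(mem_primePowBall_zero_iff_valued F v b₁).2 ((valuation_coord_le_one_iff F E v w₀ (hδw w₀) b₁).1 (hX w₀ 1 0)), fun w => hX w 0 0,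
      (mem_primePowBall_zero_iff_valued F v b₂).2 ((valuation_coord_le_one_iff F E v w₀ (hδw w₀) b₂).1 (hX w₀ 0 1))⟩
  · rintro ⟨hb₁, hz, hb₂⟩ w
    have hx := isIntegralLoc_coord_of_mem F E v hb₁ fun w => (hδv w).le
    have hy := isIntegralLoc_coord_of_mem F E v hb₂ fun w => (hδv w).le
    have hσ : IsIntegralLoc F E v (-UnitaryGroup.conjLocal E c v z) := (IsIntegralLoc.conj c hz).neg
    refine (isIntegralAt_of_isIntegralLoc F E v (fun i j => ?_) w).mul (hDi w)
    fin_cases i <;> fin_cases j <;> simp [hx, hy, hz, hσ]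

include hJ₂D hDD hDD' hQm h2 hδv hDw hDiw in
/-- **NON-SPLIT: the integral coordinate box of ★ (F-GK-2) IS `N_Δ(F_v) ∩ K_v`** (`w` the place above `v`, `z = 1_w ζ`; surjectivity of the coordinates
★ `exists_homeomorph_coordTwo`). [cite: HarrisKudlaSweet1996, §6 (6.14)–(6.16)] [cite: Casselman1980, §3] -/
theorem box_eq_setOf_mem_localInt_of_forall_eq (w : PlacesOver E v) (hw : ∀ w' : PlacesOver E v, w' = w) :
    {u : unipDeltaLocal F E c v 2 (JD := J₂D) | ∃ b₁ ∈ primePowBall (v.adicCompletion F) 0, ∃ ζ ∈ primePowBall (w.1.adicCompletion E) 0,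
        ∃ b₂ ∈ primePowBall (v.adicCompletion F) 0, (u : UnitaryGroup.localPi E c (2 + 2) J₂D v) =
          FrameTransport.frameConj F E c v (2 + 2) hJ₂D (antidiagonal_over_eq_map F E 2) Q hQ (toLocalFour F E c v
            (nSiegel (UnitaryGroup.LocalRing E v) (UnitaryGroup.conjLocal E c v) (UnitaryGroup.conjLocal_conjLocal c v hcδ hδ)
              (UnitaryGroup.toLocalRing E v b₁ * algebraMap E (UnitaryGroup.LocalRing E v) δ) (Pi.single w ζ)
              (UnitaryGroup.toLocalRing E v b₂ * algebraMap E (UnitaryGroup.LocalRing E v) δ) (conjLocal_coord F E c hcδ v b₁) (conjLocal_coord F E c hcδ v b₂)))} =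
      {u : unipDeltaLocal F E c v 2 (JD := J₂D) | (u : UnitaryGroup.localPi E c (2 + 2) J₂D v) ∈ UnitaryGroup.localInt E c (2 + 2) J₂D v} := by
  ext u
  simp only [Set.mem_setOf_eq]
  constructor
  · rintro ⟨b₁, hb₁, ζ, hζ, b₂, hb₂, hu⟩
    rw [hu, frameConj_nSiegel_coord_mem_localInt_iff F E c hcδ hδ v hJ₂D D Dinv hDD hDD' Q hQm hQ h2 hδv hDw hDiw]
    exact ⟨hb₁, isIntegralLoc_single_of_mem F E v hζ, hb₂⟩
  · intro hu
    obtain ⟨e3, he3, -⟩ := exists_homeomorph_coordTwo F E c hcδ hδ v hJ₂D D Dinv hDD hDD' Q hQm hQ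
    obtain ⟨⟨b₁, z, b₂⟩, rfl⟩ := e3.surjective u
    rw [he3] at hu ⊢
    obtain ⟨hb₁, hz, hb₂⟩ := (frameConj_nSiegel_coord_mem_localInt_iff F E c hcδ hδ v hJ₂D D Dinv hDD hDD' Q hQm hQ h2 hδv hDw hDiw b₁ z b₂).1 hu
    refine ⟨b₁, hb₁, z w, (mem_primePowBall_zero_iff_valued E w.1 (z w)).2 ((valuation_le_one_iff_valued E w.1 _).1 (hz w)), b₂, hb₂, ?_⟩
    rw [← eq_single F E v hw z]

include hJ₂D hDD hDD' hQm h2 hδv hDw hDiw in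
/-- **SPLIT: the integral coordinate box of ★ (F-GK-2s) IS `N_Δ(F_v) ∩ K_v`** (`w₁ ≠ w₂` the places above `v`, `z = 1_{w₁} ζ₁ + 1_{w₂} ζ₂`).
[cite: HarrisKudlaSweet1996, §6 (6.16)] [cite: Casselman1980, §3] -/
theorem box_eq_setOf_mem_localInt_of_pair (w₁ w₂ : PlacesOver E v) (hne : w₁ ≠ w₂) (hw : ∀ w' : PlacesOver E v, w' = w₁ ∨ w' = w₂) :
    {u : unipDeltaLocal F E c v 2 (JD := J₂D) | ∃ b₁ ∈ primePowBall (v.adicCompletion F) 0, ∃ ζ₁ ∈ primePowBall (w₁.1.adicCompletion E) 0,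
        ∃ ζ₂ ∈ primePowBall (w₂.1.adicCompletion E) 0, ∃ b₂ ∈ primePowBall (v.adicCompletion F) 0, (u : UnitaryGroup.localPi E c (2 + 2) J₂D v) =
          FrameTransport.frameConj F E c v (2 + 2) hJ₂D (antidiagonal_over_eq_map F E 2) Q hQ (toLocalFour F E c v
            (nSiegel (UnitaryGroup.LocalRing E v) (UnitaryGroup.conjLocal E c v) (UnitaryGroup.conjLocal_conjLocal c v hcδ hδ)
              (UnitaryGroup.toLocalRing E v b₁ * algebraMap E (UnitaryGroup.LocalRing E v) δ) (Pi.single w₁ ζ₁ + Pi.single w₂ ζ₂)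
              (UnitaryGroup.toLocalRing E v b₂ * algebraMap E (UnitaryGroup.LocalRing E v) δ) (conjLocal_coord F E c hcδ v b₁) (conjLocal_coord F E c hcδ v b₂)))} =
      {u : unipDeltaLocal F E c v 2 (JD := J₂D) | (u : UnitaryGroup.localPi E c (2 + 2) J₂D v) ∈ UnitaryGroup.localInt E c (2 + 2) J₂D v} := by
  ext u
  simp only [Set.mem_setOf_eq]
  constructor
  · rintro ⟨b₁, hb₁, ζ₁, hζ₁, ζ₂, hζ₂, b₂, hb₂, hu⟩
    rw [hu, frameConj_nSiegel_coord_mem_localInt_iff F E c hcδ hδ v hJ₂D D Dinv hDD hDD' Q hQm hQ h2 hδv hDw hDiw]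
    exact ⟨hb₁, (isIntegralLoc_single_of_mem F E v hζ₁).add (isIntegralLoc_single_of_mem F E v hζ₂), hb₂⟩
  · intro hu
    obtain ⟨e3, he3, -⟩ := exists_homeomorph_coordTwo F E c hcδ hδ v hJ₂D D Dinv hDD hDD' Q hQm hQ
    obtain ⟨⟨b₁, z, b₂⟩, rfl⟩ := e3.surjective u
    rw [he3] at hu ⊢
    obtain ⟨hb₁, hz, hb₂⟩ := (frameConj_nSiegel_coord_mem_localInt_iff F E c hcδ hδ v hJ₂D D Dinv hDD hDD' Q hQm hQ h2 hδv hDw hDiw b₁ z b₂).1 hu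
    refine ⟨b₁, hb₁, z w₁, (mem_primePowBall_zero_iff_valued E w₁.1 (z w₁)).2 ((valuation_le_one_iff_valued E w₁.1 _).1 (hz w₁)),
      z w₂, (mem_primePowBall_zero_iff_valued E w₂.1 (z w₂)).2 ((valuation_le_one_iff_valued E w₂.1 _).1 (hz w₂)), b₂, hb₂, ?_⟩
    rw [← eq_single_add_single F E v hne hw z]

end Summit.HodgeConjecture.HodgeConjecture.Cruxes.HLiu418.K2LiuSiegelCocycleLettersLocalInt

end
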